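import Literature.NumberTheory.GaloisRepresentations.ContinuousCorestriction
import HarnessLib

/-!
# The relative corestriction on continuous `H¹` is `Gal`-equivariant:
# `cor_{H′/H} ∘ (g·) = (g·) ∘ cor_{H′/H}` — TOOL file 1b of row T-DER-BN
# (cell `b2b-bsdres`, team n1011, seat p15 GEN 6; skeleton `cells/n1011/skel/T-DER-BN.md` §1 (S2))

HONEST FRAMING (cell `b2b-bsdres`, run/shared/lean/b2b/bsd-rank1-residual/, verbatim in every
file): the goal of the cell is to DELETE the COMBINATION-SHAPED residual classes of the
Birch–Swinnerton-Dyer formula for ALL analytic-rank `≤ 1` elliptic curves over `ℚ` — "full BSD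
formula for every rank `≤ 1` curve in class `C`" assembled STRICTLY from published theorems — so
that the rank-`≤ 1` remainder becomes exactly the CONSTRUCTION-SHAPED classes, which are TYPED
(missing-input `Prop`s), NOT attempted. This is not "finishing BSD". Team n1011 (N10 / N11, the
additive block X4 ∧ `p = 3`): research route on the CONSTRUCTION-SHAPED class X4; no claim beyond the
stated classes; nothing is booked. TOOL theorems of continuous group cohomology (no definition, no
named fact, no `sorry`); group-free, ring-free, curve-free.

## What

For subgroups `H ≤ H′` of a topological group `G`, BOTH normal in `G`, with `H` open and of finite
index in `H′`, and a topological representation `X` of `G`, the relative corestriction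
`cor_{H′/H} = coresLe X h : H¹(H, X) → H¹(H′, X)` of `ContinuousCorestriction` commutes with the
action `conjMap` of every `g ∈ G` (`(g·φ)(x) = g φ(g⁻¹ x g)`):
**`coresLe (g · y) = g · coresLe y`** (`coresLe_conjMap`).  On cocycles: if the transfer of `φ` is
computed with representatives `s`, the transfer of `g · φ` is `g ·` the transfer of `φ` computed
with the conjugated representatives `c ↦ g⁻¹ s(g c g⁻¹) g` (the class does not depend on the
representatives, `coresWith_eq_cores`).  For `G = Γ_K`, `H′ = Gal(K̄/F) ≥ H = Gal(K̄/F′)` this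
says that `Cor_{F′/F} : H¹(F′, X) → H¹(F, X)` is a homomorphism of `Gal(F/K)`-modules — used in
row T-DER-BN (S2) to move Kolyvagin's derivative operator `D_r = ∏ Σ j σ_ℓ^j` through the
corestriction `Cor_{K_i(r)/K(r)}` of the Euler-system norm relation in the `K_∞`-direction.

References: J. Neukirch, A. Schmidt, K. Wingberg, *Cohomology of Number Fields* (2008), I §5
(compatibility of cor with conjugation, Prop. 1.5.4); J.-P. Serre, *Local Fields* (1979), VII §5–§7.
-/

noncomputable section

open CategoryTheory Function Finset

universe u v

namespace Summit.BirchSwinnertonDyer.Rank1Residual.GaloisImage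

namespace Derivative

namespace Mackey

open Literature.NumberTheory.GaloisRepresentations
open Literature.NumberTheory.EllipticCurves (schreierElt schreierElt_mem schreierElt_coe
  subgroupInclusion subgroupInclusion_apply_coe subgroupConj subgroupConj_apply_coe
  conj_mem_of_normal)

variable {R : Type u} [CommRing R] [TopologicalSpace R]
variable {G : Type v} [Group G] [TopologicalSpace G] [IsTopologicalGroup G]

section Galois

variable (X : TopRep.{v} R G) {H H' : Subgroup G} [H.Normal] [H'.Normal] (h : H ≤ H')

/-- Conjugation `a ↦ σ⁻¹ a σ` of `H′` respects the cosets of `H ∩ H′` (`H` normal). [folklore] -/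
theorem leftRel_subgroupConj (σ : G) (a b : H')
    (hab : QuotientGroup.leftRel (H.subgroupOf H') a b) :
    QuotientGroup.leftRel (H.subgroupOf H') (subgroupConj H' σ a) (subgroupConj H' σ b) := by
  rw [QuotientGroup.leftRel_apply, Subgroup.mem_subgroupOf] at hab ⊢
  rw [← map_inv, ← map_mul, subgroupConj_apply_coe]
  exact conj_mem_of_normal H σ ⟨_, hab⟩

/-- `σ⁻¹ (σ a σ⁻¹) σ = a` on `H′`. [folklore] -/
theorem subgroupConj_subgroupConj_inv (σ : G) (a : H') :
    subgroupConj H' σ (subgroupConj H' σ⁻¹ a) = a :=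
  Subtype.ext (by simp only [subgroupConj_apply_coe, inv_inv]; group)

/-- `σ (σ⁻¹ a σ) σ⁻¹ = a` on `H′`. [folklore] -/
theorem subgroupConj_inv_subgroupConj (σ : G) (a : H') :
    subgroupConj H' σ⁻¹ (subgroupConj H' σ a) = a :=
  Subtype.ext (by simp only [subgroupConj_apply_coe, inv_inv]; group)

/-- **`cor_{H′/H}` is `Gal`-equivariant**: for `H ≤ H′` both normal in `G`, `H` open of finite index
in `H′`, and `g ∈ G`, `coresLe X h hH (g · y) = g · coresLe X h hH y` on `H¹(H, X)`.  On cocycles,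
with representatives `s` of `H′/H` and the conjugated representatives
`s′(c) = g⁻¹ s(g c g⁻¹) g`: `(transfer_s (g·φ))(x) = Σ_c s(xc) g φ(g⁻¹ [s(xc)⁻¹ x s(c)] g)` and
`(g · transfer_{s′} φ)(x) = g Σ_{c′} s′(x^g c′) φ(s′(x^g c′)⁻¹ x^g s′(c′))`, `x^g = g⁻¹ x g`, agree
term by term along `c = g c′ g⁻¹`.  (NSW (2008) Prop. 1.5.4: `cor` commutes with conjugation
`σ_*`; for `G = Γ_K` this is the `Gal(F/K)`-linearity of `Cor_{F′/F}`.)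
[cite: NeukirchSchmidtWingberg2008, I §5 Prop. 1.5.4] -/
theorem coresLe_conjMap (hH : IsOpen (H : Set G)) [Fintype (H' ⧸ H.subgroupOf H')] (g : G)
    (y : continuousCohomology 1 (subgroupRep X H)) :
    coresLe X h hH (conjMap X H g 1 y) = conjMap X H' g 1 (coresLe X h hH y) := by
  classical
  obtain ⟨φ, rfl⟩ := oneCocycleClass_surjective _ y
  -- conjugation by `g` on `H′ ⧸ (H ∩ H′)` and its inverse
  let β : H' ⧸ H.subgroupOf H' → H' ⧸ H.subgroupOf H' :=
    Quotient.map' (subgroupConj H' g⁻¹) (leftRel_subgroupConj g⁻¹)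
  let β' : H' ⧸ H.subgroupOf H' → H' ⧸ H.subgroupOf H' :=
    Quotient.map' (subgroupConj H' g) (leftRel_subgroupConj g)
  have hβ : ∀ a : H', β (a : H' ⧸ H.subgroupOf H') =
      ((subgroupConj H' g⁻¹ a : H') : H' ⧸ H.subgroupOf H') := fun _ => rfl
  have hβ' : ∀ a : H', β' (a : H' ⧸ H.subgroupOf H') =
      ((subgroupConj H' g a : H') : H' ⧸ H.subgroupOf H') := fun _ => rfl
  have hββ' : ∀ c, β (β' c) = c := fun c => by
    induction c using QuotientGroup.induction_on with
    | H a => rw [hβ', hβ, subgroupConj_inv_subgroupConj]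
  have hβ'β : ∀ c, β' (β c) = c := fun c => by
    induction c using QuotientGroup.induction_on with
    | H a => rw [hβ, hβ', subgroupConj_subgroupConj_inv]
  let eβ : H' ⧸ H.subgroupOf H' ≃ H' ⧸ H.subgroupOf H' := ⟨β, β', hβ'β, hββ'⟩
  -- twisted equivariance `β ((g⁻¹ x g) • c) = x • β c`
  have hβsmul : ∀ (x : H') (c : H' ⧸ H.subgroupOf H'),
      β (subgroupConj H' g x • c) = x • β c := fun x c => by
    induction c using QuotientGroup.induction_on with
    | H a =>
      rw [MulAction.Quotient.smul_coe, smul_eq_mul, hβ, hβ, MulAction.Quotient.smul_coe,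
        smul_eq_mul, map_mul, subgroupConj_inv_subgroupConj]
  -- representatives `s` and the conjugated representatives `s′`
  set s : H' ⧸ H.subgroupOf H' → H' := Quotient.out with hs_def
  have hs : ∀ c, (s c : H' ⧸ H.subgroupOf H') = c := QuotientGroup.out_eq'
  set s' : H' ⧸ H.subgroupOf H' → H' := fun c => subgroupConj H' g (s (β c)) with hs'_def
  have hs'c : ∀ c, s' c = subgroupConj H' g (s (β c)) := fun _ => rfl
  have hs' : ∀ c, (s' c : H' ⧸ H.subgroupOf H') = c := fun c => by
    rw [hs'c, ← hβ', hs, hβ'β]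
  rw [conjMap_oneCocycleClass, coresLe_oneCocycleClass X h hH hs,
    coresLe_oneCocycleClass X h hH hs', conjMap_oneCocycleClass]
  refine congrArg _ (Subtype.ext (ContinuousMap.ext fun x => ?_))
  rw [transferCocycle_apply, transferFun_apply, conj_pullback_apply, transferCocycle_apply,
    transferFun_apply, map_sum]
  conv_lhs => rw [← eβ.sum_comp]
  refine Finset.sum_congr rfl fun c _ => ?_
  have heβ : (eβ c : H' ⧸ H.subgroupOf H') = β c := rfl
  rw [heβ, hs'c, hβsmul]
  change X.ρ ((s (x • β c) : H') : G) (X.ρ g (φ.1 (subgroupConj H g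
      (subgroupOfHom h (schreierElt (H.subgroupOf H') hs x (β c)))))) =
    X.ρ g (X.ρ ((subgroupConj H' g (s (x • β c)) : H') : G)
      (φ.1 (subgroupOfHom h (schreierElt (H.subgroupOf H') hs' (subgroupConj H' g x) c))))
  rw [← ρ_mul_apply X g, subgroupConj_apply_coe,
    show g * (g⁻¹ * ((s (x • β c) : H') : G) * g) = ((s (x • β c) : H') : G) * g by group,
    ρ_mul_apply]
  congr 3
  apply Subtype.ext
  simp only [subgroupConj_apply_coe, subgroupOfHom_apply_coe, schreierElt_coe, hs'c, hβsmul,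
    Subgroup.coe_mul, Subgroup.coe_inv]
  group

end Galois

end Mackey

end Derivative

end Summit.BirchSwinnertonDyer.Rank1Residual.GaloisImage

end
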